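import Mathlib
import HarnessLib
import Summits.Ventures.LatticeQCDFlow.Scoring.ChainMartingaleFourthMoment

/-!
# The squared block martingale minus its compensator is itself a martingale with ONE-STEP
# increments: `M_{s,b}² − Σ_{i<b} q(X_{s+i}) = Σ_{i<b} η_{s,i}`,
# `η_{s,i} = 2 M_{s,i} D_{s+i} + (D_{s+i}² − q(X_{s+i}))`, `|η_{s,i}| ≤ 8 C_h² (i+1)`, `η_{s,i} ⟂ past`,
# `E η_{s,i}² ≤ 50 C_h⁴ (i+1)`, `E η_{s,i}⁴ ≤ 2¹⁷ C_h⁸ (i+1)²`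

HONEST FRAMING: exact (Metropolis-corrected) sampling algorithms for lattice gauge theory;
figures of merit are autocorrelation/cost numbers at stated couplings and volumes; no
continuum-physics claim.

Venture `LatticeQCDFlow` (cell pub-lqcd), topic `Scoring`; FANOUT row 4 (`s0-u1-b`, GEN-30).
NEW WORK of the cell, not a published result; no definition is introduced; nothing is cited as a
fact.  Notation of `Scoring/ChainMartingaleIncrements.lean` (`P_{μ₀}` the chain's path law from ANY
initial law, `|h| ≤ C_h` measurable, `D_t = h(X_{t+1}) − kop κ h(X_t)`, `M_{s,i} = Σ_{r<i} D_{s+r}`,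
`q = kop κ (h²) − (kop κ h)²` the conditional variance of an increment).  WHY (row 4's `τ_int`
column): the batch-means estimator `σ̂²_{a,b}` of the asymptotic variance is, up to negligible terms,
`(1/a) Σ_j M_{bj,b}²/b`; its fluctuation `√a (σ̂² − σ²)` is therefore governed by
`Σ_j (M_{bj,b}² − Σ_i q(X_{bj+i}))/(√a b)`, and the point of this file is that this is a sum over
SINGLE TIME STEPS of martingale differences `η_{s,i}/(√a b)` that are uniformly small
(`≤ 8 C_h²/√a`) — the shape required by the array form of McLeish's theorem
(`Scoring/MartingaleArrayCLT.lean`), where a block-level martingale argument would need increments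
of size `b/√a`.

## Content (`P_{μ₀}` from any `μ₀`; `|h| ≤ C_h` measurable; all `s, i`)

* **`sqIncr_sum_eq`** — the telescoping identity `Σ_{i<b} η_{s,i} = M_{s,b}² − Σ_{i<b} q(X_{s+i})`
  (pointwise, for any operator in place of `kop κ` and any `q`);
* `sqIncr_dependsOn` (`η_{s,i}` depends on coordinates `≤ s+i+1`), `measurable_sqIncr`,
  **`abs_sqIncr_le`** (`|η_{s,i}| ≤ 8 C_h² (i+1)`);
* **`chain_sqIncr_orthogonal`** — `E_{μ₀}[G · η_{s,i}] = 0` for bounded measurable `G` with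
  `DependsOn G (Set.Iic (s+i))` (increment orthogonality + conditional second moment);
* **`chain_sqIncr_sq_le`** — `E_{μ₀}[η_{s,i}²] ≤ 50 C_h⁴ (i+1)`;
* **`chain_sqIncr_fourth_le`** — `E_{μ₀}[η_{s,i}⁴] ≤ 2¹⁷ C_h⁸ (i+1)²` (from `E M_{s,i}⁴ ≤ (4i²+44i) C_h⁴`).

NOT CLAIMED: sharp constants; unbounded `h`; anything about a concrete sampler.
-/

noncomputable section

namespace Summit.Ventures.LatticeQCDFlow.Scoring

open MeasureTheory ProbabilityTheory Filter Finset Preorder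
open scoped ENNReal Topology

variable {Ω : Type*} [MeasurableSpace Ω]

/-! ### Pointwise identities -/

section Pointwise

omit [MeasurableSpace Ω] in
/-- **THE TELESCOPING IDENTITY** `Σ_{i<b} (2 M_{s,i} D_{s+i} + (D_{s+i}² − q(x_{s+i})))
= M_{s,b}² − Σ_{i<b} q(x_{s+i})`, for any "operator" `K` and any `q`. -/
theorem sqIncr_sum_eq (K : (Ω → ℝ) → Ω → ℝ) (h q : Ω → ℝ) (x : ℕ → Ω) (s : ℕ) :
    ∀ b : ℕ, ∑ i ∈ Finset.range b,
        (2 * (∑ r ∈ Finset.range i, (h (x (s + r + 1)) - K h (x (s + r))))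
            * (h (x (s + i + 1)) - K h (x (s + i)))
          + ((h (x (s + i + 1)) - K h (x (s + i))) ^ 2 - q (x (s + i))))
      = (∑ r ∈ Finset.range b, (h (x (s + r + 1)) - K h (x (s + r)))) ^ 2
        - ∑ i ∈ Finset.range b, q (x (s + i))
  | 0 => by simp
  | b + 1 => by
    rw [Finset.sum_range_succ, sqIncr_sum_eq K h q x s b, Finset.sum_range_succ,
      Finset.sum_range_succ]
    ring

omit [MeasurableSpace Ω] in
/-- `η_{s,i}` depends only on the coordinates up to time `s + i + 1`. -/
theorem sqIncr_dependsOn (K : (Ω → ℝ) → Ω → ℝ) (h q : Ω → ℝ) (s i : ℕ) :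
    DependsOn (fun x : ℕ → Ω =>
      2 * (∑ r ∈ Finset.range i, (h (x (s + r + 1)) - K h (x (s + r))))
          * (h (x (s + i + 1)) - K h (x (s + i)))
        + ((h (x (s + i + 1)) - K h (x (s + i))) ^ 2 - q (x (s + i)))) (Set.Iic (s + i + 1)) := by
  intro x y hxy
  have hM := blockMartingale_dependsOn K h s i (fun j hj => hxy j (Set.mem_Iic.2
    ((Set.mem_Iic.1 hj).trans (Nat.le_succ _))))
  have h1 : x (s + i + 1) = y (s + i + 1) := hxy _ (Set.mem_Iic.2 le_rfl)
  have h0 : x (s + i) = y (s + i) := hxy _ (Set.mem_Iic.2 (Nat.le_succ _))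
  dsimp only at hM ⊢
  rw [hM, h1, h0]

variable (κ : Kernel Ω Ω) [IsMarkovKernel κ]

omit [IsMarkovKernel κ] in
/-- `η_{s,i}` is measurable on path space. -/
theorem measurable_sqIncr {h : Ω → ℝ} (hh : Measurable h) (s i : ℕ) :
    Measurable fun x : ℕ → Ω => (2 * (∑ r ∈ Finset.range i, (h (x (s + r + 1)) - kop κ h (x (s + r)))) * (h (x (s + i + 1)) - kop κ h (x (s + i))) + ((h (x (s + i + 1)) - kop κ h (x (s + i))) ^ 2 - (kop κ (fun y => h y ^ 2) (x (s + i)) - (kop κ h (x (s + i))) ^ 2))) := by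
  have hD : Measurable fun x : ℕ → Ω => (h (x (s + i + 1)) - kop κ h (x (s + i))) :=
    (hh.comp (measurable_pi_apply _)).sub ((measurable_kop κ hh).comp (measurable_pi_apply _))
  have hq : Measurable fun x : ℕ → Ω => (kop κ (fun y => h y ^ 2) (x (s + i)) - (kop κ h (x (s + i))) ^ 2) :=
    ((measurable_kop κ (hh.pow_const 2)).sub ((measurable_kop κ hh).pow_const 2)).comp
      (measurable_pi_apply _)
  exact ((measurable_const.mul (blockMartingale_measurable κ hh s i)).mul hD).add
    ((hD.pow_const 2).sub hq)

/-- **`|η_{s,i}| ≤ 8 C_h² (i + 1)`.** -/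
theorem abs_sqIncr_le {h : Ω → ℝ} (hh : Measurable h) {Ch : ℝ} (hCh : ∀ x, |h x| ≤ Ch)
    (s i : ℕ) (x : ℕ → Ω) : |(2 * (∑ r ∈ Finset.range i, (h (x (s + r + 1)) - kop κ h (x (s + r)))) * (h (x (s + i + 1)) - kop κ h (x (s + i))) + ((h (x (s + i + 1)) - kop κ h (x (s + i))) ^ 2 - (kop κ (fun y => h y ^ 2) (x (s + i)) - (kop κ h (x (s + i))) ^ 2)))| ≤ 8 * Ch ^ 2 * (i + 1) := by
  have hC0 : 0 ≤ Ch := (abs_nonneg _).trans (hCh (x 0))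
  have hM := abs_blockMartingale_le κ hCh s i x
  have hD : |(h (x (s + i + 1)) - kop κ h (x (s + i)))| ≤ 2 * Ch :=
    (abs_sub _ _).trans (by linarith [hCh (x (s + i + 1)), abs_kop_le κ hCh (x (s + i))])
  have hq := (kopCondVar_bounded_measurable κ hh hCh).2 (x (s + i))
  have hD2 : |(h (x (s + i + 1)) - kop κ h (x (s + i))) ^ 2| ≤ 4 * Ch ^ 2 := by
    rw [abs_pow]; nlinarith [abs_nonneg (h (x (s + i + 1)) - kop κ h (x (s + i)))]
  have h1 : |2 * (∑ r ∈ Finset.range i, (h (x (s + r + 1)) - kop κ h (x (s + r)))) * (h (x (s + i + 1)) - kop κ h (x (s + i)))| ≤ 8 * Ch ^ 2 * i := by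
    rw [abs_mul, abs_mul, abs_two]
    have := mul_le_mul hM hD (abs_nonneg _) (by positivity)
    nlinarith
  calc |(2 * (∑ r ∈ Finset.range i, (h (x (s + r + 1)) - kop κ h (x (s + r)))) * (h (x (s + i + 1)) - kop κ h (x (s + i))) + ((h (x (s + i + 1)) - kop κ h (x (s + i))) ^ 2 - (kop κ (fun y => h y ^ 2) (x (s + i)) - (kop κ h (x (s + i))) ^ 2)))| ≤ |2 * (∑ r ∈ Finset.range i, (h (x (s + r + 1)) - kop κ h (x (s + r)))) * (h (x (s + i + 1)) - kop κ h (x (s + i)))| + |(h (x (s + i + 1)) - kop κ h (x (s + i))) ^ 2 - (kop κ (fun y => h y ^ 2) (x (s + i)) - (kop κ h (x (s + i))) ^ 2)| :=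
        abs_add_le _ _
    _ ≤ 8 * Ch ^ 2 * i + (4 * Ch ^ 2 + Ch ^ 2) :=
        add_le_add h1 ((abs_sub _ _).trans (add_le_add hD2 hq))
    _ ≤ 8 * Ch ^ 2 * (i + 1) := by nlinarith [sq_nonneg Ch]

end Pointwise

/-! ### Along the chain: orthogonality and moments -/

section Chain

variable (κ : Kernel Ω Ω) [IsMarkovKernel κ] (μ₀ : Measure Ω) [IsProbabilityMeasure μ₀]

/-- **`η_{s,i}` IS ORTHOGONAL TO THE PAST**: `E_{μ₀}[G · η_{s,i}] = 0` for bounded measurable `G` with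
`DependsOn G (Set.Iic (s + i))`. -/
theorem chain_sqIncr_orthogonal {h : Ω → ℝ} (hh : Measurable h) {Ch : ℝ} (hCh : ∀ x, |h x| ≤ Ch)
    (s i : ℕ) {G : (ℕ → Ω) → ℝ} (hG : Measurable G) (hGd : DependsOn G (Set.Iic (s + i)))
    {CG : ℝ} (hCG : ∀ x, |G x| ≤ CG) :
    ∫ x, G x * (2 * (∑ r ∈ Finset.range i, (h (x (s + r + 1)) - kop κ h (x (s + r)))) * (h (x (s + i + 1)) - kop κ h (x (s + i))) + ((h (x (s + i + 1)) - kop κ h (x (s + i))) ^ 2 - (kop κ (fun y => h y ^ 2) (x (s + i)) - (kop κ h (x (s + i))) ^ 2))) ∂(Kernel.trajMeasure (X := fun _ : ℕ => Ω) (μ₀)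
          (fun n : ℕ => κ.comap (fun h' : (i : ↥(Finset.Iic n)) → Ω => h' ⟨n, Finset.mem_Iic.2 le_rfl⟩)
            (measurable_pi_apply _))) = 0 := by
  set P := (Kernel.trajMeasure (X := fun _ : ℕ => Ω) (μ₀)
        (fun n : ℕ => κ.comap (fun h' : (i : ↥(Finset.Iic n)) → Ω => h' ⟨n, Finset.mem_Iic.2 le_rfl⟩)
          (measurable_pi_apply _))) with hP
  have hC0 : 0 ≤ Ch := (abs_nonneg _).trans (hCh (Classical.choice
    (nonempty_of_isProbabilityMeasure μ₀)))
  have hCG0 : 0 ≤ CG := (abs_nonneg _).trans (hCG (fun _ => Classical.choice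
    (nonempty_of_isProbabilityMeasure μ₀)))
  -- the pieces
  have hMm := blockMartingale_measurable κ hh s i
  have hMb := abs_blockMartingale_le κ hCh s i
  have hMd := blockMartingale_dependsOn (kop κ) h s i
  obtain ⟨hqm, hqb⟩ := kopCondVar_bounded_measurable κ hh hCh
  have hDm : Measurable fun x : ℕ → Ω => (h (x (s + i + 1)) - kop κ h (x (s + i))) :=
    (hh.comp (measurable_pi_apply _)).sub ((measurable_kop κ hh).comp (measurable_pi_apply _))
  have hDb : ∀ x : ℕ → Ω, |(h (x (s + i + 1)) - kop κ h (x (s + i)))| ≤ 2 * Ch := fun x =>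
    (abs_sub _ _).trans (by linarith [hCh (x (s + i + 1)), abs_kop_le κ hCh (x (s + i))])
  -- (1) `E[(G · 2M) · D] = 0`
  have hGMm : Measurable fun x : ℕ → Ω => G x * (2 * (∑ r ∈ Finset.range i, (h (x (s + r + 1)) - kop κ h (x (s + r))))) :=
    hG.mul (measurable_const.mul hMm)
  have hGMd : DependsOn (fun x : ℕ → Ω => G x * (2 * (∑ r ∈ Finset.range i, (h (x (s + r + 1)) - kop κ h (x (s + r)))))) (Set.Iic (s + i)) := by
    intro x y hxy
    have hM' := hMd hxy
    dsimp only at hM'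
    show G x * (2 * (∑ r ∈ Finset.range i, (h (x (s + r + 1)) - kop κ h (x (s + r))))) = G y * (2 * (∑ r ∈ Finset.range i,
      (h (y (s + r + 1)) - kop κ h (y (s + r)))))
    rw [hGd hxy, hM']
  have hGMb : ∀ x : ℕ → Ω, |G x * (2 * (∑ r ∈ Finset.range i, (h (x (s + r + 1)) - kop κ h (x (s + r)))))| ≤ CG * (2 * (i * (2 * Ch))) := fun x => by
    rw [abs_mul, abs_mul, abs_two]
    exact mul_le_mul (hCG x) (mul_le_mul_of_nonneg_left (hMb x) zero_le_two) (by positivity) hCG0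
  have h1 := chain_increment_orthogonal κ μ₀ (s + i) hGMm hGMd hGMb hh hCh
  rw [← hP] at h1
  -- (2) `E[G · D²] = E[G · q(X_{s+i})]`
  have h2 := chain_increment_sq κ μ₀ (s + i) hG hGd hCG hh hCh
  rw [← hP] at h2
  -- integrability
  have hi1 : Integrable (fun x : ℕ → Ω => G x * (2 * (∑ r ∈ Finset.range i, (h (x (s + r + 1)) - kop κ h (x (s + r))))) * (h (x (s + i + 1)) - kop κ h (x (s + i)))) P :=
    integrable_of_bounded P (hGMm.mul hDm) (C := CG * (2 * (i * (2 * Ch))) * (2 * Ch)) fun x => by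
      rw [abs_mul]; exact mul_le_mul (hGMb x) (hDb x) (abs_nonneg _) (by positivity)
  have hi2 : Integrable (fun x : ℕ → Ω => G x * (h (x (s + i + 1)) - kop κ h (x (s + i))) ^ 2) P :=
    integrable_of_bounded P (hG.mul (hDm.pow_const 2)) (C := CG * (2 * Ch) ^ 2) fun x => by
      rw [abs_mul, abs_pow]
      exact mul_le_mul (hCG x) (pow_le_pow_left₀ (abs_nonneg _) (hDb x) 2) (by positivity) hCG0
  have hi3 : Integrable (fun x : ℕ → Ω => G x * (kop κ (fun y => h y ^ 2) (x (s + i)) - (kop κ h (x (s + i))) ^ 2)) P :=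
    integrable_of_bounded P (hG.mul (hqm.comp (measurable_pi_apply _))) (C := CG * Ch ^ 2)
      fun x => by rw [abs_mul]; exact mul_le_mul (hCG x) (hqb _) (abs_nonneg _) hCG0
  have hexp : ∀ x : ℕ → Ω, G x * (2 * (∑ r ∈ Finset.range i, (h (x (s + r + 1)) - kop κ h (x (s + r)))) * (h (x (s + i + 1)) - kop κ h (x (s + i))) + ((h (x (s + i + 1)) - kop κ h (x (s + i))) ^ 2 - (kop κ (fun y => h y ^ 2) (x (s + i)) - (kop κ h (x (s + i))) ^ 2)))
      = G x * (2 * (∑ r ∈ Finset.range i, (h (x (s + r + 1)) - kop κ h (x (s + r))))) * (h (x (s + i + 1)) - kop κ h (x (s + i))) + (G x * (h (x (s + i + 1)) - kop κ h (x (s + i))) ^ 2 - G x * (kop κ (fun y => h y ^ 2) (x (s + i)) - (kop κ h (x (s + i))) ^ 2)) :=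
    fun x => by ring
  have hi23 : Integrable (fun x : ℕ → Ω => G x * (h (x (s + i + 1)) - kop κ h (x (s + i))) ^ 2 - G x * (kop κ (fun y => h y ^ 2) (x (s + i)) - (kop κ h (x (s + i))) ^ 2)) P :=
    hi2.sub hi3
  rw [integral_congr_ae (ae_of_all _ hexp), integral_add hi1 hi23, integral_sub hi2 hi3,
    h1, h2, sub_self, add_zero]

/-- **`E_{μ₀}[η_{s,i}²] ≤ 50 C_h⁴ (i + 1)`.** -/
theorem chain_sqIncr_sq_le {h : Ω → ℝ} (hh : Measurable h) {Ch : ℝ} (hCh : ∀ x, |h x| ≤ Ch)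
    (s i : ℕ) :
    ∫ x, (2 * (∑ r ∈ Finset.range i, (h (x (s + r + 1)) - kop κ h (x (s + r)))) * (h (x (s + i + 1)) - kop κ h (x (s + i))) + ((h (x (s + i + 1)) - kop κ h (x (s + i))) ^ 2 - (kop κ (fun y => h y ^ 2) (x (s + i)) - (kop κ h (x (s + i))) ^ 2))) ^ 2 ∂(Kernel.trajMeasure (X := fun _ : ℕ => Ω) (μ₀)
          (fun n : ℕ => κ.comap (fun h' : (i : ↥(Finset.Iic n)) → Ω => h' ⟨n, Finset.mem_Iic.2 le_rfl⟩)
            (measurable_pi_apply _))) ≤ 50 * Ch ^ 4 * (i + 1) := by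
  set P := (Kernel.trajMeasure (X := fun _ : ℕ => Ω) (μ₀)
        (fun n : ℕ => κ.comap (fun h' : (i : ↥(Finset.Iic n)) → Ω => h' ⟨n, Finset.mem_Iic.2 le_rfl⟩)
          (measurable_pi_apply _))) with hP
  have hC0 : 0 ≤ Ch := (abs_nonneg _).trans (hCh (Classical.choice
    (nonempty_of_isProbabilityMeasure μ₀)))
  have hMm := blockMartingale_measurable κ hh s i
  have hMb := abs_blockMartingale_le κ hCh s i
  obtain ⟨hqm, hqb⟩ := kopCondVar_bounded_measurable κ hh hCh
  have hDb : ∀ x : ℕ → Ω, |(h (x (s + i + 1)) - kop κ h (x (s + i)))| ≤ 2 * Ch := fun x =>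
    (abs_sub _ _).trans (by linarith [hCh (x (s + i + 1)), abs_kop_le κ hCh (x (s + i))])
  have hM2 := chain_blockMartingale_sq_le κ μ₀ hh hCh s i
  rw [← hP] at hM2
  -- pointwise: `η² ≤ 32 C_h² M² + 50 C_h⁴`
  have hpt : ∀ x : ℕ → Ω, (2 * (∑ r ∈ Finset.range i, (h (x (s + r + 1)) - kop κ h (x (s + r)))) * (h (x (s + i + 1)) - kop κ h (x (s + i))) + ((h (x (s + i + 1)) - kop κ h (x (s + i))) ^ 2 - (kop κ (fun y => h y ^ 2) (x (s + i)) - (kop κ h (x (s + i))) ^ 2))) ^ 2 ≤ 32 * Ch ^ 2 * (∑ r ∈ Finset.range i, (h (x (s + r + 1)) - kop κ h (x (s + r)))) ^ 2 + 50 * Ch ^ 4 := by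
    intro x
    have hD := hDb x
    have hq := hqb (x (s + i))
    rw [abs_le] at hD hq
    have hD2 : (h (x (s + i + 1)) - kop κ h (x (s + i))) ^ 2 ≤ 4 * Ch ^ 2 := by nlinarith
    have hE : ((h (x (s + i + 1)) - kop κ h (x (s + i))) ^ 2 - (kop κ (fun y => h y ^ 2) (x (s + i)) - (kop κ h (x (s + i))) ^ 2)) ^ 2 ≤ 25 * Ch ^ 4 := by
      have h5 : |(h (x (s + i + 1)) - kop κ h (x (s + i))) ^ 2 - (kop κ (fun y => h y ^ 2) (x (s + i)) - (kop κ h (x (s + i))) ^ 2)| ≤ 5 * Ch ^ 2 := by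
        rw [abs_le]; constructor <;> nlinarith
      have := pow_le_pow_left₀ (abs_nonneg _) h5 2
      rw [sq_abs] at this
      linarith [this, show (5 * Ch ^ 2) ^ 2 = 25 * Ch ^ 4 by ring]
    have hA : (2 * (∑ r ∈ Finset.range i, (h (x (s + r + 1)) - kop κ h (x (s + r)))) * (h (x (s + i + 1)) - kop κ h (x (s + i)))) ^ 2 ≤ 16 * Ch ^ 2 * (∑ r ∈ Finset.range i, (h (x (s + r + 1)) - kop κ h (x (s + r)))) ^ 2 := by
      have : (2 * (∑ r ∈ Finset.range i, (h (x (s + r + 1)) - kop κ h (x (s + r)))) * (h (x (s + i + 1)) - kop κ h (x (s + i)))) ^ 2 = 4 * (∑ r ∈ Finset.range i, (h (x (s + r + 1)) - kop κ h (x (s + r)))) ^ 2 * (h (x (s + i + 1)) - kop κ h (x (s + i))) ^ 2 := by ring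
      rw [this]; nlinarith [sq_nonneg (∑ r ∈ Finset.range i, (h (x (s + r + 1)) - kop κ h (x (s + r))))]
    have hsq2 : ∀ u v : ℝ, (u + v) ^ 2 ≤ 2 * u ^ 2 + 2 * v ^ 2 := fun u v => by
      nlinarith [sq_nonneg (u - v)]
    calc (2 * (∑ r ∈ Finset.range i, (h (x (s + r + 1)) - kop κ h (x (s + r)))) * (h (x (s + i + 1)) - kop κ h (x (s + i))) + ((h (x (s + i + 1)) - kop κ h (x (s + i))) ^ 2 - (kop κ (fun y => h y ^ 2) (x (s + i)) - (kop κ h (x (s + i))) ^ 2))) ^ 2 ≤ 2 * (2 * (∑ r ∈ Finset.range i, (h (x (s + r + 1)) - kop κ h (x (s + r)))) * (h (x (s + i + 1)) - kop κ h (x (s + i)))) ^ 2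
          + 2 * ((h (x (s + i + 1)) - kop κ h (x (s + i))) ^ 2 - (kop κ (fun y => h y ^ 2) (x (s + i)) - (kop κ h (x (s + i))) ^ 2)) ^ 2 := hsq2 _ _
      _ ≤ 32 * Ch ^ 2 * (∑ r ∈ Finset.range i, (h (x (s + r + 1)) - kop κ h (x (s + r)))) ^ 2 + 50 * Ch ^ 4 := by linarith
  have hiM2 : Integrable (fun x : ℕ → Ω => (∑ r ∈ Finset.range i, (h (x (s + r + 1)) - kop κ h (x (s + r)))) ^ 2) P :=
    integrable_of_bounded P (hMm.pow_const 2) (C := (i * (2 * Ch)) ^ 2) fun x => by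
      rw [abs_pow]; exact pow_le_pow_left₀ (abs_nonneg _) (hMb x) 2
  have hiR : Integrable (fun x : ℕ → Ω => 32 * Ch ^ 2 * (∑ r ∈ Finset.range i, (h (x (s + r + 1)) - kop κ h (x (s + r)))) ^ 2 + 50 * Ch ^ 4) P :=
    (hiM2.const_mul _).add (integrable_const _)
  calc ∫ x, (2 * (∑ r ∈ Finset.range i, (h (x (s + r + 1)) - kop κ h (x (s + r)))) * (h (x (s + i + 1)) - kop κ h (x (s + i))) + ((h (x (s + i + 1)) - kop κ h (x (s + i))) ^ 2 - (kop κ (fun y => h y ^ 2) (x (s + i)) - (kop κ h (x (s + i))) ^ 2))) ^ 2 ∂P ≤ ∫ x, (32 * Ch ^ 2 * (∑ r ∈ Finset.range i, (h (x (s + r + 1)) - kop κ h (x (s + r)))) ^ 2 + 50 * Ch ^ 4) ∂P :=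
        integral_mono_of_nonneg (ae_of_all _ fun x => sq_nonneg _) hiR (ae_of_all _ hpt)
    _ = 32 * Ch ^ 2 * ∫ x, (∑ r ∈ Finset.range i, (h (x (s + r + 1)) - kop κ h (x (s + r)))) ^ 2 ∂P + 50 * Ch ^ 4 := by
        rw [integral_add (hiM2.const_mul _) (integrable_const _), integral_const_mul,
          integral_const, probReal_univ, one_smul]
    _ ≤ 32 * Ch ^ 2 * (i * Ch ^ 2) + 50 * Ch ^ 4 := by
        have := mul_le_mul_of_nonneg_left hM2 (by positivity : (0 : ℝ) ≤ 32 * Ch ^ 2)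
        linarith
    _ ≤ 50 * Ch ^ 4 * (i + 1) := by
        nlinarith [mul_nonneg (Nat.cast_nonneg (α := ℝ) i) (pow_nonneg (sq_nonneg Ch) 2)]

/-- **`E_{μ₀}[η_{s,i}⁴] ≤ 2¹⁷ C_h⁸ (i + 1)²`.** -/
theorem chain_sqIncr_fourth_le {h : Ω → ℝ} (hh : Measurable h) {Ch : ℝ} (hCh : ∀ x, |h x| ≤ Ch)
    (s i : ℕ) :
    ∫ x, (2 * (∑ r ∈ Finset.range i, (h (x (s + r + 1)) - kop κ h (x (s + r)))) * (h (x (s + i + 1)) - kop κ h (x (s + i))) + ((h (x (s + i + 1)) - kop κ h (x (s + i))) ^ 2 - (kop κ (fun y => h y ^ 2) (x (s + i)) - (kop κ h (x (s + i))) ^ 2))) ^ 4 ∂(Kernel.trajMeasure (X := fun _ : ℕ => Ω) (μ₀)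
          (fun n : ℕ => κ.comap (fun h' : (i : ↥(Finset.Iic n)) → Ω => h' ⟨n, Finset.mem_Iic.2 le_rfl⟩)
            (measurable_pi_apply _))) ≤ 2 ^ 17 * Ch ^ 8 * ((i : ℝ) + 1) ^ 2 := by
  set P := (Kernel.trajMeasure (X := fun _ : ℕ => Ω) (μ₀)
        (fun n : ℕ => κ.comap (fun h' : (i : ↥(Finset.Iic n)) → Ω => h' ⟨n, Finset.mem_Iic.2 le_rfl⟩)
          (measurable_pi_apply _))) with hP
  have hC0 : 0 ≤ Ch := (abs_nonneg _).trans (hCh (Classical.choice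
    (nonempty_of_isProbabilityMeasure μ₀)))
  have hMm := blockMartingale_measurable κ hh s i
  have hMb := abs_blockMartingale_le κ hCh s i
  obtain ⟨hqm, hqb⟩ := kopCondVar_bounded_measurable κ hh hCh
  have hDb : ∀ x : ℕ → Ω, |(h (x (s + i + 1)) - kop κ h (x (s + i)))| ≤ 2 * Ch := fun x =>
    (abs_sub _ _).trans (by linarith [hCh (x (s + i + 1)), abs_kop_le κ hCh (x (s + i))])
  have hM4 := chain_blockMartingale_fourth_le κ μ₀ hh hCh s i
  rw [← hP] at hM4
  -- pointwise: `η⁴ ≤ 2048 C_h⁴ M⁴ + 5000 C_h⁸`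
  have hpt : ∀ x : ℕ → Ω, (2 * (∑ r ∈ Finset.range i, (h (x (s + r + 1)) - kop κ h (x (s + r)))) * (h (x (s + i + 1)) - kop κ h (x (s + i))) + ((h (x (s + i + 1)) - kop κ h (x (s + i))) ^ 2 - (kop κ (fun y => h y ^ 2) (x (s + i)) - (kop κ h (x (s + i))) ^ 2))) ^ 4 ≤ 2048 * Ch ^ 4 * (∑ r ∈ Finset.range i, (h (x (s + r + 1)) - kop κ h (x (s + r)))) ^ 4 + 5000 * Ch ^ 8 := by
    intro x
    have hD := hDb x
    have hq := hqb (x (s + i))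
    rw [abs_le] at hD hq
    have hD2 : (h (x (s + i + 1)) - kop κ h (x (s + i))) ^ 2 ≤ 4 * Ch ^ 2 := by nlinarith
    have h5 : |(h (x (s + i + 1)) - kop κ h (x (s + i))) ^ 2 - (kop κ (fun y => h y ^ 2) (x (s + i)) - (kop κ h (x (s + i))) ^ 2)| ≤ 5 * Ch ^ 2 := by
      rw [abs_le]; constructor <;> nlinarith
    have hE : ((h (x (s + i + 1)) - kop κ h (x (s + i))) ^ 2 - (kop κ (fun y => h y ^ 2) (x (s + i)) - (kop κ h (x (s + i))) ^ 2)) ^ 4 ≤ 625 * Ch ^ 8 := by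
      have := pow_le_pow_left₀ (abs_nonneg _) h5 4
      rw [Even.pow_abs (by norm_num : Even 4)] at this
      linarith [this, show (5 * Ch ^ 2) ^ 4 = 625 * Ch ^ 8 by ring]
    have hA : (2 * (∑ r ∈ Finset.range i, (h (x (s + r + 1)) - kop κ h (x (s + r)))) * (h (x (s + i + 1)) - kop κ h (x (s + i)))) ^ 4 ≤ 256 * Ch ^ 4 * (∑ r ∈ Finset.range i, (h (x (s + r + 1)) - kop κ h (x (s + r)))) ^ 4 := by
      have hD4 : (h (x (s + i + 1)) - kop κ h (x (s + i))) ^ 4 ≤ 16 * Ch ^ 4 := by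
        have := pow_le_pow_left₀ (sq_nonneg _) hD2 2
        linarith [this, show ((h (x (s + i + 1)) - kop κ h (x (s + i))) ^ 2) ^ 2 = (h (x (s + i + 1)) - kop κ h (x (s + i))) ^ 4 by ring,
          show (4 * Ch ^ 2) ^ 2 = 16 * Ch ^ 4 by ring]
      have : (2 * (∑ r ∈ Finset.range i, (h (x (s + r + 1)) - kop κ h (x (s + r)))) * (h (x (s + i + 1)) - kop κ h (x (s + i)))) ^ 4 = 16 * (∑ r ∈ Finset.range i, (h (x (s + r + 1)) - kop κ h (x (s + r)))) ^ 4 * (h (x (s + i + 1)) - kop κ h (x (s + i))) ^ 4 := by ring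
      rw [this]; nlinarith [sq_nonneg ((∑ r ∈ Finset.range i, (h (x (s + r + 1)) - kop κ h (x (s + r)))) ^ 2)]
    have hp4 : ∀ u v : ℝ, (u + v) ^ 4 ≤ 8 * (u ^ 4 + v ^ 4) := fun u v => by
      have e : 8 * (u ^ 4 + v ^ 4) - (u + v) ^ 4
          = (u - v) ^ 2 * (7 * u ^ 2 + 10 * u * v + 7 * v ^ 2) := by ring
      have e2 : 0 ≤ 7 * u ^ 2 + 10 * u * v + 7 * v ^ 2 := by
        nlinarith [sq_nonneg (u + v), sq_nonneg (u - v)]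
      nlinarith [mul_nonneg (sq_nonneg (u - v)) e2]
    calc (2 * (∑ r ∈ Finset.range i, (h (x (s + r + 1)) - kop κ h (x (s + r)))) * (h (x (s + i + 1)) - kop κ h (x (s + i))) + ((h (x (s + i + 1)) - kop κ h (x (s + i))) ^ 2 - (kop κ (fun y => h y ^ 2) (x (s + i)) - (kop κ h (x (s + i))) ^ 2))) ^ 4 ≤ 8 * ((2 * (∑ r ∈ Finset.range i, (h (x (s + r + 1)) - kop κ h (x (s + r)))) * (h (x (s + i + 1)) - kop κ h (x (s + i)))) ^ 4
          + ((h (x (s + i + 1)) - kop κ h (x (s + i))) ^ 2 - (kop κ (fun y => h y ^ 2) (x (s + i)) - (kop κ h (x (s + i))) ^ 2)) ^ 4) := hp4 _ _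
      _ ≤ 2048 * Ch ^ 4 * (∑ r ∈ Finset.range i, (h (x (s + r + 1)) - kop κ h (x (s + r)))) ^ 4 + 5000 * Ch ^ 8 := by linarith
  have hiM4 : Integrable (fun x : ℕ → Ω => (∑ r ∈ Finset.range i, (h (x (s + r + 1)) - kop κ h (x (s + r)))) ^ 4) P :=
    integrable_of_bounded P (hMm.pow_const 4) (C := (i * (2 * Ch)) ^ 4) fun x => by
      rw [abs_pow]; exact pow_le_pow_left₀ (abs_nonneg _) (hMb x) 4
  have hiR : Integrable (fun x : ℕ → Ω => 2048 * Ch ^ 4 * (∑ r ∈ Finset.range i, (h (x (s + r + 1)) - kop κ h (x (s + r)))) ^ 4 + 5000 * Ch ^ 8) P :=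
    (hiM4.const_mul _).add (integrable_const _)
  calc ∫ x, (2 * (∑ r ∈ Finset.range i, (h (x (s + r + 1)) - kop κ h (x (s + r)))) * (h (x (s + i + 1)) - kop κ h (x (s + i))) + ((h (x (s + i + 1)) - kop κ h (x (s + i))) ^ 2 - (kop κ (fun y => h y ^ 2) (x (s + i)) - (kop κ h (x (s + i))) ^ 2))) ^ 4 ∂P ≤ ∫ x, (2048 * Ch ^ 4 * (∑ r ∈ Finset.range i, (h (x (s + r + 1)) - kop κ h (x (s + r)))) ^ 4 + 5000 * Ch ^ 8) ∂P :=
        integral_mono_of_nonneg (ae_of_all _ fun x => by positivity) hiR (ae_of_all _ hpt)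
    _ = 2048 * Ch ^ 4 * ∫ x, (∑ r ∈ Finset.range i, (h (x (s + r + 1)) - kop κ h (x (s + r)))) ^ 4 ∂P + 5000 * Ch ^ 8 := by
        rw [integral_add (hiM4.const_mul _) (integrable_const _), integral_const_mul,
          integral_const, probReal_univ, one_smul]
    _ ≤ 2048 * Ch ^ 4 * ((4 * (i : ℝ) ^ 2 + 44 * i) * Ch ^ 4) + 5000 * Ch ^ 8 := by
        have := mul_le_mul_of_nonneg_left hM4 (by positivity : (0 : ℝ) ≤ 2048 * Ch ^ 4)
        linarith
    _ ≤ 2 ^ 17 * Ch ^ 8 * ((i : ℝ) + 1) ^ 2 := by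
        nlinarith [pow_nonneg hC0 8, mul_nonneg (pow_nonneg hC0 8) (Nat.cast_nonneg (α := ℝ) i),
          mul_nonneg (pow_nonneg hC0 8) (sq_nonneg (i : ℝ))]

end Chain

end Summit.Ventures.LatticeQCDFlow.Scoring

end
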